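import Summits.Schanuel.Schanuel.Theorems.RootDecomp1EllipticNormalForm01

/-!
# RootDecomp1 — the ELLIPTIC NORMAL FORM of piece D's cubic stratum (the vertex ladder) · part 02 of 2
(cell decomp-schanuel · lens-1 «grading / quantitative ladder» · g23 · route `route-Schanuel-RootDecomp1`,
piece D = `DisjointSaturatedEssentialSchanuel`, stmt-Schanuel-30353; continues part 01, same namespace; see the
module docstring of part 01 for the thesis, the honest label, prior art and barrier placement)

* §5 DESCENT (`not_spanMinimal_of_ratFrame`, `schanuel_ineq_of_ratFrame_relation`, unconditional): a relation
  among `ℚ`-independent logarithms `λ` factoring through a RATIONAL frame `w = Mλ`, `M ∈ M_{r×n}(ℚ)`, `r < n`,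
  gives `trdeg ℚ(w, e^w) < r` and contradicts D's span-minimality binder: D is vacuous on every cell of
  rational hull rank `< n` (at `n = 3`: rational-direction cylinders over plane cubics are `SchanuelTwo`'s).
* §6 EQUIVALENCE (`exists_affineLog_eq`, `logFree_iff_coneCells`): every `ℚ̄`-linearly independent
  `m ∈ L̃ʳ` is an affine-log tuple, so `ELF(E) ⟺` «no cone cell over `E`, at any level `n`, carries a
  `ℚ`-linearly independent point of `𝓛ⁿ`» — the vertex ladder of the cubic stratum collapses onto one
  `n`-free statement per plane cubic `E`.
* §7 ON-PATH (`algebraicIndependent_linForms`, `eval_linLog_ne_zero_of_algIndepLogarithms`,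
  `eval_linLog_ne_zero_of_schanuel`): `AlgIndepLogarithms` (hence the summit) makes the values of independent
  LINEAR forms in independent logarithms algebraically independent over `ℚ̄` (left-inverse substitution), which
  yields `ELF(E)` cell by cell.  `Schanuel`/`AlgIndepLogarithms` occur only as hypotheses; no `Prop`
  definitions, instances, notation or axioms.
-/

noncomputable section

open Complex
open scoped BigOperators

namespace Summit.Schanuel.Schanuel.Theorems.RootDecomp1EllipticNormalForm

open Literature.Barriers.Schanuel (logLinearForms logQSpan AlgIndepLogarithms
  algIndepLogarithms_of_schanuel trdeg_adjoin_union_eq_of_isAlgebraic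
  algebraicIndependent_of_le_trdeg_adjoin isAlgebraic_cexp_of_mem_logQSpan)

/-! ## §5 Descent: relations of rational hull rank `< n` violate span-minimality (D is vacuous there) -/

/-- If `λ` is `ℚ`-linearly independent and `M ∈ M_{r×n}(ℚ)` has `ℚ`-linearly independent rows, then the
RATIONAL FRAME `wᵢ = ∑ₖ Mᵢₖ λₖ` is `ℚ`-linearly independent. [folklore] -/
theorem linearIndependent_ratFrame {n r : ℕ} (l : Fin n → ℂ) (hli : LinearIndependent ℚ l)
    (M : Fin r → Fin n → ℚ) (hM : LinearIndependent ℚ M) :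
    LinearIndependent ℚ (fun i => ∑ k, (M i k : ℂ) * l k) := by
  rw [Fintype.linearIndependent_iff]
  intro q hq
  have hq' : ∑ k, (∑ i, q i * M i k) • l k = 0 := by
    rw [← hq]
    simp only [Rat.smul_def, Rat.cast_sum, Rat.cast_mul, Finset.mul_sum, Finset.sum_mul]
    rw [Finset.sum_comm]
    exact Finset.sum_congr rfl fun i _ => Finset.sum_congr rfl fun k _ => by ring
  have hk := Fintype.linearIndependent_iff.mp hli _ hq'
  have hvec : ∑ i, q i • M i = 0 := by
    funext k
    simpa only [Finset.sum_apply, Pi.smul_apply, smul_eq_mul, Pi.zero_apply] using hk k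
  exact Fintype.linearIndependent_iff.mp hM q hvec

/-- The entries of a rational frame in logarithms of algebraic numbers are logarithms of algebraic numbers
(`𝓛 = logQSpan` is a `ℚ`-space). [cite: Roy1995, §1 (Preliminaries)] -/
theorem ratFrame_mem_logQSpan {n r : ℕ} (l : Fin n → ℂ) (halg : ∀ k, IsAlgebraic ℚ (cexp (l k)))
    (M : Fin r → Fin n → ℚ) (i : Fin r) : ∑ k, (M i k : ℂ) * l k ∈ logQSpan := by
  unfold logQSpan
  refine Submodule.sum_mem _ fun k _ => ?_
  rw [← Rat.smul_def]
  exact Submodule.smul_mem _ _ (Submodule.subset_span (halg k))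

/-- **DESCENT.**  If a non-trivial algebraic relation with algebraic coefficients among the logarithms `λ`
factors through a RATIONAL frame `wᵢ = ∑ₖ Mᵢₖ λₖ`, `M ∈ M_{r×n}(ℚ)` — `G(w) = 0`, `G ≠ 0` — then
`trdeg ℚ(w, e^w) < r`: the `e^{wᵢ}` are algebraic, so `trdeg ℚ(w, e^w) = trdeg ℚ(w)`, and `w` is not
algebraically independent over `ℚ` (else over `ℚ̄`, `eval_ne_zero_of_algebraicIndependent`). [folklore] -/
theorem trdeg_ratFrame_lt {n r : ℕ} (l : Fin n → ℂ) (halg : ∀ k, IsAlgebraic ℚ (cexp (l k)))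
    (M : Fin r → Fin n → ℚ) (G : MvPolynomial (Fin r) ℂ)
    (hG : ∀ m, IsAlgebraic ℚ (MvPolynomial.coeff m G)) (hG0 : G ≠ 0)
    (hrel : MvPolynomial.eval (fun i => ∑ k, (M i k : ℂ) * l k) G = 0) :
    Algebra.trdeg ℚ ↥(IntermediateField.adjoin ℚ
        (Set.range (fun i => ∑ k, (M i k : ℂ) * l k) ∪
          Set.range (Complex.exp ∘ fun i => ∑ k, (M i k : ℂ) * l k))) < r := by
  have hwalg : ∀ x ∈ Set.range (Complex.exp ∘ fun i => ∑ k, (M i k : ℂ) * l k), IsAlgebraic ℚ x := by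
    rintro _ ⟨i, rfl⟩
    exact isAlgebraic_cexp_of_mem_logQSpan (ratFrame_mem_logQSpan l halg M i)
  have hlt : Algebra.trdeg ℚ ↥(IntermediateField.adjoin ℚ
      (Set.range (fun i => ∑ k, (M i k : ℂ) * l k))) < r := by
    by_contra hge
    rw [not_lt] at hge
    exact eval_ne_zero_of_algebraicIndependent (algebraicIndependent_of_le_trdeg_adjoin _ hge) G hG hG0
      hrel
  exact (trdeg_adjoin_union_eq_of_isAlgebraic _ _ hwalg).trans_lt hlt

/-- **SPAN-MINIMALITY FAILS on a cell of rational hull rank `r < n`.**  Piece D's third binder (inherited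
from the essential-counterexample reduction, item `EssentialCounterexamplesInEcl`) demands Schanuel's
inequality for every `ℚ`-linearly independent `w ∈ (span_ℚ λ)^m`, `m < n`; a relation among `λ` that
factors through a rational `r`-frame, `r < n`, refutes it at `m = r`.  Hence such cells carry NO member of
D's residue in degree `n` — they belong to degree `r` (for the cubic stratum at `n = 3`: cylinders over a
plane cubic in a RATIONAL direction descend to `SchanuelTwo`'s logarithmic sector). [folklore] -/
theorem not_spanMinimal_of_ratFrame {n r : ℕ} (hr : r < n) (l : Fin n → ℂ)
    (halg : ∀ k, IsAlgebraic ℚ (cexp (l k))) (hli : LinearIndependent ℚ l)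
    (M : Fin r → Fin n → ℚ) (hM : LinearIndependent ℚ M)
    (G : MvPolynomial (Fin r) ℂ) (hG : ∀ m, IsAlgebraic ℚ (MvPolynomial.coeff m G)) (hG0 : G ≠ 0)
    (hrel : MvPolynomial.eval (fun i => ∑ k, (M i k : ℂ) * l k) G = 0) :
    ¬ (∀ (m : ℕ), m < n → ∀ (w : Fin m → ℂ), LinearIndependent ℚ w →
        (∀ i, w i ∈ Submodule.span ℚ (Set.range l)) →
        (m : Cardinal) ≤ Algebra.trdeg ℚ
          ↥(IntermediateField.adjoin ℚ (Set.range w ∪ Set.range (Complex.exp ∘ w)))) := by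
  intro hmin
  have hspan : ∀ i, (fun i => ∑ k, (M i k : ℂ) * l k) i ∈ Submodule.span ℚ (Set.range l) :=
    fun i => Submodule.sum_mem _ fun k _ => by
      rw [← Rat.smul_def]
      exact Submodule.smul_mem _ _ (Submodule.subset_span ⟨k, rfl⟩)
  have h := hmin r hr _ (linearIndependent_ratFrame l hli M hM) hspan
  exact absurd (trdeg_ratFrame_lt l halg M G hG hG0 hrel) (not_lt.mpr h)

/-- **Piece D is VACUOUS on every cell of rational hull rank `< n`, in D's own format.**  At a
`ℚ`-linearly independent `z ∈ 𝓛ⁿ` whose (cubic, or any) relation factors through a rational `r`-frame with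
`r < n`, D's span-minimality binder is contradictory, so D's conclusion holds. (Binder copied verbatim from
`DisjointSaturatedEssentialSchanuel`, stmt-Schanuel-30353, third hypothesis.) [folklore] -/
theorem schanuel_ineq_of_ratFrame_relation {n r : ℕ} (hr : r < n) (z : Fin n → ℂ)
    (hz : LinearIndependent ℚ z) (halg : ∀ k, IsAlgebraic ℚ (Complex.exp (z k)))
    (M : Fin r → Fin n → ℚ) (hM : LinearIndependent ℚ M)
    (G : MvPolynomial (Fin r) ℂ) (hG : ∀ m, IsAlgebraic ℚ (MvPolynomial.coeff m G)) (hG0 : G ≠ 0)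
    (hrel : MvPolynomial.eval (fun i => ∑ k, (M i k : ℂ) * z k) G = 0)
    (hmin : ∀ (m : ℕ), m < n → ∀ (w : Fin m → ℂ), LinearIndependent ℚ w →
        (∀ i, w i ∈ Submodule.span ℚ (Set.range z)) →
        (m : Cardinal) ≤ Algebra.trdeg ℚ
          ↥(IntermediateField.adjoin ℚ (Set.range w ∪ Set.range (Complex.exp ∘ w)))) :
    (n : Cardinal) ≤ Algebra.trdeg ℚ
      ↥(IntermediateField.adjoin ℚ (Set.range z ∪ Set.range (Complex.exp ∘ z))) :=
  absurd hmin (not_spanMinimal_of_ratFrame hr z halg hz M hM G hG hG0 hrel)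

/-! ## §6 The converse: the cone cells over all `n` recover the normal form (an equivalence) -/

/-- Expansion of a `ℚ̄`-combination of affine-form values:
`∑ⱼ gⱼ (cⱼ + ∑ₖ aⱼₖ xₖ) = (∑ⱼ gⱼcⱼ) + ∑ₖ (∑ⱼ gⱼaⱼₖ) xₖ`. [folklore] -/
theorem sum_mul_affine {n r : ℕ} (g c : Fin r → ℂ) (a : Fin r → Fin n → ℂ) (x : Fin n → ℂ) :
    ∑ j, g j * (c j + ∑ k, a j k * x k) = (∑ j, g j * c j) + ∑ k, (∑ j, g j * a j k) * x k := by
  simp only [mul_add, Finset.sum_add_distrib, Finset.mul_sum, Finset.sum_mul]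
  congr 1
  rw [Finset.sum_comm]
  exact Finset.sum_congr rfl fun j _ => Finset.sum_congr rfl fun k _ => by ring

/-- **Every `ℚ̄`-linearly independent tuple of `L̃` is an affine-log tuple.**  If `m ∈ L̃ʳ` has
`ℚ̄`-linearly independent coordinates, there are a `ℚ`-linearly independent tuple `λ ∈ 𝓛ⁿ` of logarithms
of algebraic numbers (a `ℚ`-basis of the logarithms occurring in `m`) and `r` affine forms
`ℓⱼ = cⱼX₀ + ∑ₖ aⱼₖXₖ` with algebraic coefficients, `ℚ̄`-linearly independent as coefficient vectors, with
`mⱼ = ℓⱼ(1, λ)`.  (So the point `m` lies on `E = 0` iff `λ` lies on the cone `E ∘ ℓ = 0`.) [folklore] -/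
theorem exists_affineLog_eq {r : ℕ} (m : Fin r → ℂ) (hm : ∀ j, m j ∈ logLinearForms)
    (hmi : LinearIndependent (algebraicClosure ℚ ℂ) m) :
    ∃ (n : ℕ) (l : Fin n → ℂ) (c : Fin r → ℂ) (a : Fin r → Fin n → ℂ),
      (∀ k, IsAlgebraic ℚ (cexp (l k))) ∧ LinearIndependent ℚ l ∧
      (∀ j, IsAlgebraic ℚ (c j)) ∧ (∀ j k, IsAlgebraic ℚ (a j k)) ∧
      LinearIndependent (algebraicClosure ℚ ℂ)
        (fun j => (Fin.cons (c j) (a j) : Fin (n + 1) → ℂ)) ∧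
      ∀ j, m j = c j + ∑ k, a j k * l k := by
  classical
  -- Step 1: finite expansions `m j = ∑_{s ∈ t j} f j s • s`, `t j ⊆ {1} ∪ logs`
  have hexp : ∀ j, ∃ (f : ℂ → algebraicClosure ℚ ℂ) (t : Finset ℂ),
      (↑t : Set ℂ) ⊆ ({1} ∪ {z : ℂ | IsAlgebraic ℚ (cexp z)} : Set ℂ) ∧
      Function.support f ⊆ ↑t ∧ ∑ s ∈ t, f s • s = m j := fun j =>
    Submodule.mem_span_iff_exists_finset_subset.1 (hm j)
  choose f t ht hft hsum using hexp
  -- a common finset `U ∋ 1` carrying all expansions; `T = U \ {1}` consists of logarithms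
  set U : Finset ℂ := insert 1 (Finset.univ.biUnion t) with hU
  set T : Finset ℂ := U.erase 1 with hT
  have hTlog : ∀ s ∈ T, IsAlgebraic ℚ (cexp s) := by
    intro s hs
    obtain ⟨hs1, hsU⟩ := Finset.mem_erase.mp hs
    rcases Finset.mem_insert.mp hsU with h1 | h2
    · exact absurd h1 hs1
    · obtain ⟨j, -, hj⟩ := Finset.mem_biUnion.mp h2
      rcases ht j hj with h3 | h4
      · exact absurd (Set.mem_singleton_iff.mp h3) hs1
      · exact h4
  have hmU : ∀ j, m j = (f j 1 : ℂ) + ∑ s ∈ T, (f j s : ℂ) * s := by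
    intro j
    have h1 : ∑ s ∈ U, f j s • s = m j := by
      rw [← hsum j]
      refine (Finset.sum_subset (fun s hs => ?_) (fun s _ hs => ?_)).symm
      · exact Finset.mem_insert_of_mem (Finset.mem_biUnion.mpr ⟨j, Finset.mem_univ _, hs⟩)
      · have h0 : f j s = 0 := by
          by_contra hne
          exact hs (hft j (Function.mem_support.mpr hne))
        rw [h0, zero_smul]
    rw [← h1, ← Finset.add_sum_erase U _ (Finset.mem_insert_self 1 _)]
    simp only [IntermediateField.smul_def, smul_eq_mul, mul_one]
    rfl
  -- Step 2: a `ℚ`-basis `λ` of `span_ℚ T`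
  obtain ⟨b, hbT, hbspan, hbli⟩ := exists_linearIndependent ℚ (T : Set ℂ)
  have hbfin : b.Finite := T.finite_toSet.subset hbT
  haveI : Fintype b := hbfin.fintype
  set n : ℕ := Fintype.card b with hn
  set e : Fin n ≃ b := (Fintype.equivFin b).symm with he
  set l : Fin n → ℂ := fun k => (e k : ℂ) with hl
  have hlli : LinearIndependent ℚ l := hbli.comp _ e.injective
  have hlalg : ∀ k, IsAlgebraic ℚ (cexp (l k)) := fun k => hTlog _ (hbT (e k).2)
  have hrange : Set.range l = b := by
    ext x
    constructor
    · rintro ⟨k, rfl⟩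
      exact (e k).2
    · intro hx
      exact ⟨e.symm ⟨x, hx⟩, by simp [hl]⟩
  -- each `s ∈ T` is a rational combination of `λ`
  have hsT : ∀ s ∈ T, ∃ q : Fin n → ℚ, ∑ k, q k • l k = s := by
    intro s hs
    have hs' : s ∈ Submodule.span ℚ (Set.range l) := by
      rw [hrange, hbspan]
      exact Submodule.subset_span hs
    exact (Submodule.mem_span_range_iff_exists_fun ℚ).mp hs'
  choose! q hq using hsT
  -- Step 3: the affine forms `cⱼ = fⱼ(1)`, `aⱼₖ = ∑_{s ∈ T} fⱼ(s) q_{s,k}`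
  set c : Fin r → ℂ := fun j => (f j 1 : ℂ) with hc
  set aK : Fin r → Fin n → algebraicClosure ℚ ℂ :=
    fun j k => ∑ s ∈ T, f j s * algebraMap ℚ (algebraicClosure ℚ ℂ) (q s k) with haK
  set a : Fin r → Fin n → ℂ := fun j k => (aK j k : ℂ) with ha
  have ha' : ∀ j k, a j k = ∑ s ∈ T, (f j s : ℂ) * (q s k : ℂ) := by
    intro j k
    simp only [ha, haK]
    push_cast
    rfl
  have hident : ∀ j, m j = c j + ∑ k, a j k * l k := by
    intro j
    rw [hmU j]
    congr 1
    calc ∑ s ∈ T, (f j s : ℂ) * s = ∑ s ∈ T, (f j s : ℂ) * ∑ k, (q s k : ℂ) * l k := by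
          refine Finset.sum_congr rfl fun s hs => ?_
          congr 1
          calc s = ∑ k, q s k • l k := (hq s hs).symm
            _ = ∑ k, (q s k : ℂ) * l k := by simp only [Rat.smul_def]
      _ = ∑ k, (∑ s ∈ T, (f j s : ℂ) * (q s k : ℂ)) * l k := by
          simp only [Finset.mul_sum, Finset.sum_mul]
          rw [Finset.sum_comm]
          exact Finset.sum_congr rfl fun _ _ => Finset.sum_congr rfl fun _ _ => by ring
      _ = ∑ k, a j k * l k := by simp only [ha']
  refine ⟨n, l, c, a, hlalg, hlli, fun j => mem_algebraicClosure_iff.1 (SetLike.coe_mem _),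
    fun j k => mem_algebraicClosure_iff.1 (SetLike.coe_mem _), ?_, hident⟩
  -- `ℚ̄`-independence of the forms from that of `m`
  rw [Fintype.linearIndependent_iff]
  intro g hg
  have h0 : ∑ j, (g j : ℂ) * c j = 0 := by
    have := congrFun hg 0
    simpa only [Finset.sum_apply, Pi.smul_apply, Fin.cons_zero, IntermediateField.smul_def,
      smul_eq_mul, Pi.zero_apply] using this
  have hk : ∀ k, ∑ j, (g j : ℂ) * a j k = 0 := fun k => by
    have := congrFun hg k.succ
    simpa only [Finset.sum_apply, Pi.smul_apply, Fin.cons_succ, IntermediateField.smul_def,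
      smul_eq_mul, Pi.zero_apply] using this
  have hgm : ∑ j, g j • m j = 0 := by
    simp only [IntermediateField.smul_def, smul_eq_mul]
    rw [show (∑ j, (g j : ℂ) * m j) = ∑ j, (g j : ℂ) * (c j + ∑ k, a j k * l k) from
      Finset.sum_congr rfl fun j _ => by rw [← hident j]]
    rw [sum_mul_affine, h0, zero_add]
    exact Finset.sum_eq_zero fun k _ => by rw [hk k, zero_mul]
  exact Fintype.linearIndependent_iff.mp hmi g hgm

/-- **THE NORMAL FORM IS AN EQUIVALENCE.**  For any complex polynomial `E` in `r` variables:
`E` has no zero in `L̃ʳ` with `ℚ̄`-linearly independent coordinates **iff** for every `n`, no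
`ℚ`-linearly independent `n`-tuple of logarithms of algebraic numbers lies on a cone `E ∘ ℓ = 0` over
`E = 0` with `ℚ̄`-vertex (`ℓ` = `r` `ℚ̄`-independent affine forms with algebraic coefficients).  For
`r = 3` and `E` a smooth plane cubic this identifies the whole cubic stratum of piece D's pure-logarithm
residue, over ALL degrees `n` and all vertex types, with ONE `n`-free statement about the elliptic curve
`E` over Waldschmidt's space `L̃`. (`→`: `eval_affineLog_ne_zero_of_logFree`; `←`: `exists_affineLog_eq`.)
[cite: Waldschmidt2005, §1 Conjecture 1.5] -/
theorem logFree_iff_coneCells {r : ℕ} (E : MvPolynomial (Fin r) ℂ) :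
    (∀ m : Fin r → ℂ, (∀ j, m j ∈ logLinearForms) →
      LinearIndependent (algebraicClosure ℚ ℂ) m → MvPolynomial.eval m E ≠ 0) ↔
    (∀ (n : ℕ) (l : Fin n → ℂ), (∀ k, IsAlgebraic ℚ (cexp (l k))) → LinearIndependent ℚ l →
      ∀ (c : Fin r → ℂ) (a : Fin r → Fin n → ℂ), (∀ j, IsAlgebraic ℚ (c j)) →
      (∀ j k, IsAlgebraic ℚ (a j k)) →
      LinearIndependent (algebraicClosure ℚ ℂ) (fun j => (Fin.cons (c j) (a j) : Fin (n + 1) → ℂ)) →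
      MvPolynomial.eval (fun j => c j + ∑ k, a j k * l k) E ≠ 0) := by
  constructor
  · intro hE n l halg hli c a hc ha hrank
    exact eval_affineLog_ne_zero_of_logFree E hE l halg hli c a hc ha hrank
  · intro hC m hm hmi
    obtain ⟨n, l, c, a, halg, hli, hc, ha, hrank, hident⟩ := exists_affineLog_eq m hm hmi
    have hm' : m = fun j => c j + ∑ k, a j k * l k := funext hident
    rw [hm']
    exact hC n l halg hli c a hc ha hrank

/-! ## §7 On-path for the normal form: independent LINEAR log-forms are algebraically independent -/

/-- If `x` is algebraically independent over `ℚ̄` and the `s × n` matrix `L` over `ℚ̄` has a right inverse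
`B` (`L B = 1`, i.e. the rows of `L` are linearly independent), then the linear forms `uᵢ = ∑ₖ Lᵢₖ xₖ` are
algebraically independent over `ℚ̄`: the substitution `Yᵢ ↦ ∑ₖ Lᵢₖ Xₖ` has the left inverse
`Xₖ ↦ ∑ᵢ Bₖᵢ Yᵢ`. [folklore] -/
theorem algebraicIndependent_linForms {n s : ℕ} {x : Fin n → ℂ}
    (hx : AlgebraicIndependent (algebraicClosure ℚ ℂ) x)
    (L : Fin s → Fin n → algebraicClosure ℚ ℂ) (B : Fin n → Fin s → algebraicClosure ℚ ℂ)
    (hLB : ∀ i i', ∑ k, L i k * B k i' = if i = i' then 1 else 0) :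
    AlgebraicIndependent (algebraicClosure ℚ ℂ) (fun i => ∑ k, (L i k : ℂ) * x k) := by
  classical
  rw [algebraicIndependent_iff]
  intro p hp
  set ψ : MvPolynomial (Fin s) (algebraicClosure ℚ ℂ) →ₐ[algebraicClosure ℚ ℂ]
      MvPolynomial (Fin n) (algebraicClosure ℚ ℂ) :=
    MvPolynomial.bind₁ fun i => ∑ k, MvPolynomial.C (L i k) * MvPolynomial.X k with hψ
  set τ : MvPolynomial (Fin n) (algebraicClosure ℚ ℂ) →ₐ[algebraicClosure ℚ ℂ]
      MvPolynomial (Fin s) (algebraicClosure ℚ ℂ) :=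
    MvPolynomial.bind₁ fun k => ∑ i, MvPolynomial.C (B k i) * MvPolynomial.X i with hτ
  -- `τ ∘ ψ = id`
  have hτψ : ∀ i : Fin s, τ (ψ (MvPolynomial.X i)) = MvPolynomial.X i := by
    intro i
    simp only [hψ, hτ, MvPolynomial.bind₁_X_right, map_sum, map_mul, MvPolynomial.bind₁_C_right,
      Finset.mul_sum]
    rw [Finset.sum_comm]
    have hterm : ∀ i' : Fin s, ∑ k, MvPolynomial.C (L i k) * (MvPolynomial.C (B k i') * MvPolynomial.X i')
        = MvPolynomial.C (∑ k, L i k * B k i') *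
          (MvPolynomial.X i' : MvPolynomial (Fin s) (algebraicClosure ℚ ℂ)) := by
      intro i'
      rw [map_sum, Finset.sum_mul]
      exact Finset.sum_congr rfl fun k _ => by rw [map_mul, mul_assoc]
    simp only [hterm, hLB]
    simp [apply_ite MvPolynomial.C, ite_mul, Finset.sum_ite_eq]
  have hcomp : τ.comp ψ = AlgHom.id _ _ := by
    apply MvPolynomial.algHom_ext
    intro i
    rw [AlgHom.comp_apply, hτψ, AlgHom.id_apply]
  -- `(ψ p)(x) = p(u) = 0`, hence `ψ p = 0` and `p = τ (ψ p) = 0`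
  have hψp : MvPolynomial.aeval x (ψ p) = 0 := by
    rw [hψ, MvPolynomial.aeval_bind₁]
    have hfun : (fun i => MvPolynomial.aeval x
        (∑ k, MvPolynomial.C (L i k) * MvPolynomial.X k : MvPolynomial (Fin n) (algebraicClosure ℚ ℂ)))
        = fun i => ∑ k, (L i k : ℂ) * x k := by
      funext i
      simp [map_sum]
    rw [hfun]
    exact hp
  have h0 : ψ p = 0 := hx.eq_zero_of_aeval_eq_zero _ hψp
  calc p = τ (ψ p) := by rw [← AlgHom.comp_apply, hcomp, AlgHom.id_apply]
    _ = 0 := by rw [h0, map_zero]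

/-- **AIL ⟹ independent linear log-forms are algebraically free.**  Under `AlgIndepLogarithms`
(stmt-Schanuel-4310; implied by the summit): if `λ ∈ 𝓛ⁿ` is `ℚ`-linearly independent and
`L ∈ M_{s×n}(ℚ̄)` has a right inverse `B ∈ M_{n×s}(ℚ̄)` (equivalently, independent rows), then the values
`uᵢ = ∑ₖ Lᵢₖ λₖ` satisfy NO non-trivial algebraic relation `e(u) = 0` with algebraic coefficients.  This is
the on-path certificate for every cell of the vertex ladder: a cone with finite `ℚ̄`-vertex is
`e(u) = E(c + u)` with `s = 3`, a cylinder is `e(u, v) = E(1, u, v)` with `s = 2` (and `n ≥ 4` adds vertex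
directions), so the summit implies the normal-form statement cell by cell. [cite: Waldschmidt2005, §1 Conjecture 1.1] -/
theorem eval_linLog_ne_zero_of_algIndepLogarithms (hAIL : AlgIndepLogarithms) {n s : ℕ}
    (l : Fin n → ℂ) (halg : ∀ k, IsAlgebraic ℚ (cexp (l k))) (hli : LinearIndependent ℚ l)
    (L : Fin s → Fin n → ℂ) (B : Fin n → Fin s → ℂ)
    (hL : ∀ i k, IsAlgebraic ℚ (L i k)) (hB : ∀ k i, IsAlgebraic ℚ (B k i))
    (hLB : ∀ i i', ∑ k, L i k * B k i' = if i = i' then 1 else 0)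
    (e : MvPolynomial (Fin s) ℂ) (he : ∀ m, IsAlgebraic ℚ (MvPolynomial.coeff m e)) (he0 : e ≠ 0) :
    MvPolynomial.eval (fun i => ∑ k, L i k * l k) e ≠ 0 := by
  haveI : Algebra.IsAlgebraic ℚ (algebraicClosure ℚ ℂ) := algebraicClosure.isAlgebraic ℚ ℂ
  set L₀ : Fin s → Fin n → algebraicClosure ℚ ℂ :=
    fun i k => ⟨L i k, mem_algebraicClosure_iff.2 (hL i k)⟩ with hL₀
  set B₀ : Fin n → Fin s → algebraicClosure ℚ ℂ :=
    fun k i => ⟨B k i, mem_algebraicClosure_iff.2 (hB k i)⟩ with hB₀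
  have hLB₀ : ∀ i i', ∑ k, L₀ i k * B₀ k i' = if i = i' then 1 else 0 := by
    intro i i'
    apply Subtype.ext
    have h := hLB i i'
    split_ifs at h ⊢
    · simpa [hL₀, hB₀] using h
    · simpa [hL₀, hB₀] using h
  have hx : AlgebraicIndependent (algebraicClosure ℚ ℂ) l := (hAIL n l halg hli).extendScalars _
  have hu := algebraicIndependent_linForms hx L₀ B₀ hLB₀
  have huQ : AlgebraicIndependent ℚ (fun i => ∑ k, (L₀ i k : ℂ) * l k) :=
    hu.restrictScalars (algebraMap ℚ (algebraicClosure ℚ ℂ)).injective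
  exact eval_ne_zero_of_algebraicIndependent huQ e he he0

/-- The same from the summit (`algIndepLogarithms_of_schanuel`). [cite: Waldschmidt2005, §1 Conjecture 1.1] -/
theorem eval_linLog_ne_zero_of_schanuel (hS : _root_.Schanuel) {n s : ℕ}
    (l : Fin n → ℂ) (halg : ∀ k, IsAlgebraic ℚ (cexp (l k))) (hli : LinearIndependent ℚ l)
    (L : Fin s → Fin n → ℂ) (B : Fin n → Fin s → ℂ)
    (hL : ∀ i k, IsAlgebraic ℚ (L i k)) (hB : ∀ k i, IsAlgebraic ℚ (B k i))
    (hLB : ∀ i i', ∑ k, L i k * B k i' = if i = i' then 1 else 0)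
    (e : MvPolynomial (Fin s) ℂ) (he : ∀ m, IsAlgebraic ℚ (MvPolynomial.coeff m e)) (he0 : e ≠ 0) :
    MvPolynomial.eval (fun i => ∑ k, L i k * l k) e ≠ 0 :=
  eval_linLog_ne_zero_of_algIndepLogarithms (algIndepLogarithms_of_schanuel fun k y hy => hS k y hy)
    l halg hli L B hL hB hLB e he he0

end Summit.Schanuel.Schanuel.Theorems.RootDecomp1EllipticNormalForm
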